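import Summits.QuantumFields.YangMills.Theorems.BalabanUVNodesN15KingModelComplexLinkResolvent
import Summits.QuantumFields.YangMills.Theorems.BalabanUVNodesN15KingModelComplexLinkProperTime
import Summits.QuantumFields.YangMills.Theorems.BalabanUVNodesN15KingModelComplexLinkGaugeWindow
import HarnessLib
/-!
# BalabanUVNodes ∕ N15 — THE KING-MODEL RUNG (PART Ϛ-s): PART Ϛ BY NAME, II — the operator-theoretic half of the complex window (files Ϛ-l … Ϛ-r) in two package theorems: `ℓ²` bound,
# coercivity ∕ numerical range, resolvent half-plane, heat-kernel domination and decay, the gauge-saturated window (any `𝕜`); the `ℓ²`-contraction of the semigroup and the proper-time identity (`ℂ`)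
# (Track A, DAG node N15 = NE2; FAN-OUT v1.1 §N15 s3 «KING-MODEL RUNG … + what the curved case adds»; count-neutral)
HONEST FRAMING.  Count-neutral (cell `pub-ymgap`, seat `pub-ymgap-dag-n15-e` g43; `--supports stmt-QuantumFields-27247 --as helper` = K3ᴬ, KEY MAP v3).  One finite torus at fixed
spacing; King's `A = 0` COMPARISON model, FINE covariance layer only; nothing of Bałaban's (3.42)∕(3.46)∕Thm 3.4 for `G(U)` asserted; nothing continuum ∕ ℝ⁴ ∕ OS ∕ Clay; NOT a node discharge.
This file only CONJOINS parts Ϛ-l … Ϛ-r by name (PART Ϛ-i conjoined Ϛ-a … Ϛ-k).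
* ★★★ `king_complex_window_package_two` — for `c ≥ 0`, `0 ≤ ε`, `2(d+1)cε < m²`, `‖U(b)‖,‖V(b)‖ ≤ 1+ε` (`m′² = m²−2(d+1)cε`): (i) `‖G_{U,V}‖_{ℓ²→ℓ²} ≤ 1∕m′²` (Ϛ-l); (ii) coercivity `Re⟨v,M_{U,V}v⟩ ≥ m′²‖v‖²`
  (Ϛ-m); (iii) numerical range in the disc `|z−D₀| ≤ 2(d+1)(1+ε)c` (Ϛ-m); (iv) resolvent half-plane `Re z < m′² ⟹ ‖(M−z)⁻¹‖ ≤ 1∕(m′²−Re z)` (Ϛ-q); (v) heat-kernel domination `‖(e^{−tM})_{xy}‖ ≤ (e^{−tL′})(x,y)`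
  (Ϛ-o) and (vi) `ℓ^∞` decay `Σ_y‖(e^{−tM})_{xy}‖ ≤ e^{−tm′²}` (Ϛ-p) for `t ≥ 0`; (vii) `ℓ²` decay `‖e^{−tM}‖ ≤ e^{−tm′²}` (Ϛ-r); (viii) the unitary gauge-saturated kernel bound (Ϛ-n).
* ★★ `king_complex_window_package_two_complex` (`𝕜 = ℂ`): the proper-time identity `∫₀^∞e^{t(−M_{U,V})}dt = G_{U,V}` (Ϛ-r) and its unitary case.
Dedup (rg at filing): `king_complex_window_package_two` 0 tree files.  Locators: [Balaban1985BackgroundPropagators] Thm 3.4 p.400, (3.46) p.398, p.398 l.19 ∕ l.26–27; [DodziukMathai2006] Thm 1.5 §1;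
[King1986] (4.4) p.670.  0 `sorry`, 0 `def`.
-/

noncomputable section
open scoped BigOperators ComplexConjugate ComplexOrder Topology Matrix.Norms.L2Operator
open Finset Matrix Filter MeasureTheory Set

namespace Summit.QuantumFields.YangMills.BalabanUVNodes.N15KingModelRung.Covariant

open Literature.MathematicalPhysics.QuantumFieldTheory.LatticeDiamagneticInequality (Hopping blk)
open Literature.MathematicalPhysics.QuantumFieldTheory.Balaban1983to89.B5Prop11Plancherel (Tor unitVec)
open Literature.MathematicalPhysics.QuantumFieldTheory.King1986.Torus (lapF)

variable {d : ℕ} (K : Fin (d + 1) → ℕ) [hK : ∀ μ, NeZero (K μ)]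
variable {𝕜 : Type*} [RCLike 𝕜] {n : Type*} [Fintype n] [DecidableEq n] {c m2 ε : ℝ}

/-- ★★★ **PART Ϛ BY NAME, II — THE OPERATOR-THEORETIC WINDOW**: for `c ≥ 0`, `0 ≤ ε`, `2(d+1)cε < m²` and every two-sided link field with `‖U(b)‖, ‖V(b)‖ ≤ 1+ε`
(`m′² := m² − 2(d+1)cε`): (i) `‖G_{U,V}‖_{ℓ²→ℓ²} ≤ 1∕m′²`; (ii) `Re⟨v, M_{U,V}v⟩ ≥ m′²‖v‖²`; (iii) `|⟨v,M_{U,V}v⟩ − D₀‖v‖²| ≤ 2(d+1)(1+ε)c‖v‖²`; (iv) for every `z` with `Re z < m′²`,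
`M_{U,V} − z` is invertible with `‖(M_{U,V}−z)⁻¹‖ ≤ 1∕(m′²−Re z)`; (v) `‖(e^{−tM_{U,V}})_{xy}‖ ≤ (e^{−t·lapF K ((1+ε)c) m′²})(x,y)` and (vi) `Σ_y‖(e^{−tM_{U,V}})_{xy}‖ ≤ e^{−tm′²}` and
(vii) `‖e^{−tM_{U,V}}‖_{ℓ²→ℓ²} ≤ e^{−tm′²}` for all `t ≥ 0`; (viii) if a UNITARY gauge transform of a pair `(U′,V′)` lies in the polydisc then `‖(G_{U′,V′})_{xy}‖ ≤ (lapF K ((1+ε)c) m′²)⁻¹(x,y)`.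
[cite: Balaban1985BackgroundPropagators, Thm 3.4 p.400, (3.46) p.398, p.398 l.19; DodziukMathai2006, Thm 1.5 §1; King1986, (4.4) p.670] -/
theorem king_complex_window_package_two (hc : 0 ≤ c) (hm : 0 < m2) (hε : 0 ≤ ε) (hwin : 2 * ((d : ℝ) + 1) * c * ε < m2)
    {U V : Tor K × Fin (d + 1) → Matrix n n 𝕜} (hU : ∀ b, ‖U b‖ ≤ 1 + ε) (hV : ∀ b, ‖V b‖ ≤ 1 + ε) :
    ‖(cxLapF K c m2 U V)⁻¹‖ ≤ (m2 - 2 * ((d : ℝ) + 1) * c * ε)⁻¹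
    ∧ (∀ v : Tor K × n → 𝕜, (m2 - 2 * ((d : ℝ) + 1) * c * ε) * ‖(WithLp.toLp 2 v : EuclideanSpace 𝕜 (Tor K × n))‖ ^ 2 ≤ RCLike.re (star v ⬝ᵥ (cxLapF K c m2 U V *ᵥ v)))
    ∧ (∀ v : Tor K × n → 𝕜, ‖star v ⬝ᵥ (cxLapF K c m2 U V *ᵥ v) - (((m2 + 2 * ((d : ℝ) + 1) * c : ℝ) : 𝕜)) * ((‖(WithLp.toLp 2 v : EuclideanSpace 𝕜 (Tor K × n))‖ : 𝕜)) ^ 2‖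
        ≤ 2 * ((d : ℝ) + 1) * ((1 + ε) * c) * ‖(WithLp.toLp 2 v : EuclideanSpace 𝕜 (Tor K × n))‖ ^ 2)
    ∧ (∀ {z : 𝕜}, RCLike.re z < m2 - 2 * ((d : ℝ) + 1) * c * ε →
        IsUnit (cxLapF K c m2 U V - z • (1 : Matrix (Tor K × n) (Tor K × n) 𝕜))
        ∧ ‖(cxLapF K c m2 U V - z • (1 : Matrix (Tor K × n) (Tor K × n) 𝕜))⁻¹‖ ≤ (m2 - 2 * ((d : ℝ) + 1) * c * ε - RCLike.re z)⁻¹)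
    ∧ (∀ {t : ℝ}, 0 ≤ t → ∀ x y, ‖blk (NormedSpace.exp (-((((t : ℝ) : 𝕜)) • cxLapF K c m2 U V))) x y‖
        ≤ (NormedSpace.exp (-(t • lapF K ((1 + ε) * c) (m2 - 2 * ((d : ℝ) + 1) * c * ε)))) x y)
    ∧ (∀ {t : ℝ}, 0 ≤ t → ∀ x, ∑ y, ‖blk (NormedSpace.exp (-((((t : ℝ) : 𝕜)) • cxLapF K c m2 U V))) x y‖ ≤ Real.exp (-(t * (m2 - 2 * ((d : ℝ) + 1) * c * ε))))
    ∧ (∀ {t : ℝ}, 0 ≤ t → ‖NormedSpace.exp (-((((t : ℝ) : 𝕜)) • cxLapF K c m2 U V))‖ ≤ Real.exp (-(t * (m2 - 2 * ((d : ℝ) + 1) * c * ε))))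
    ∧ (∀ {g : Tor K → Matrix n n 𝕜} {U' V' : Tor K × Fin (d + 1) → Matrix n n 𝕜}, (∀ x, g x ∈ Matrix.unitaryGroup n 𝕜) →
        (∀ b, ‖cxGaugeFwd K g U' b‖ ≤ 1 + ε) → (∀ b, ‖cxGaugeBwd K g V' b‖ ≤ 1 + ε) → ∀ x y,
        ‖blk (cxLapF K c m2 U' V')⁻¹ x y‖ ≤ (lapF K ((1 + ε) * c) (m2 - 2 * ((d : ℝ) + 1) * c * ε))⁻¹ x y) :=
  ⟨l2_opNorm_cxLapF_inv_le K hc hm hε hwin hU hV,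
   fun v => re_quadForm_cxLapF_ge K hc m2 hU hV v,
   fun v => norm_quadForm_cxLapF_sub_le K hc m2 hU hV v,
   fun hz => ⟨isUnit_cxLapF_sub_smul K hc m2 hU hV hz, l2_opNorm_cxLapF_sub_smul_inv_le K hc m2 hU hV hz⟩,
   fun ht x y => l2_opNorm_blk_exp_neg_cxLapF_le K hc ht hU hV x y,
   fun ht x => sum_l2_opNorm_blk_exp_neg_cxLapF_le K hc ht hU hV x,
   fun ht => l2_opNorm_exp_neg_cxLapF_le K hc ht hU hV,
   fun hg hU' hV' x y => l2_opNorm_blk_cxLapF_inv_le_of_unitary_gauge_window K hc hm hε hwin hg hU' hV' x y⟩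

/-- ★★ **PART Ϛ BY NAME, II — OVER `ℂ`: THE PROPER-TIME IDENTITY** on the window: `∫₀^∞ e^{t·(−M_{U,V})}dt = G_{U,V}`; and at every unitary `U`: `∫₀^∞ e^{t·(−(−cΔ_U+m²))}dt = (−cΔ_U+m²)⁻¹`.
[cite: Balaban1985BackgroundPropagators, p.398 l.26–27, Thm 3.4 p.400; DodziukMathai2006, Thm 1.5 §1; King1986, (4.4) p.670] -/
theorem king_complex_window_package_two_complex {ν : Type*} [Fintype ν] [DecidableEq ν] {c m2 ε : ℝ} (hc : 0 ≤ c) (hm : 0 < m2) (hε : 0 ≤ ε)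
    (hwin : 2 * ((d : ℝ) + 1) * c * ε < m2) {U V : Tor K × Fin (d + 1) → Matrix ν ν ℂ} (hU : ∀ b, ‖U b‖ ≤ 1 + ε) (hV : ∀ b, ‖V b‖ ≤ 1 + ε) :
    (∫ u in Ioi (0 : ℝ), NormedSpace.exp (u • (-cxLapF K c m2 U V)) = (cxLapF K c m2 U V)⁻¹)
    ∧ (∀ {U₀ : Tor K × Fin (d + 1) → Matrix ν ν ℂ}, (∀ b, U₀ b ∈ Matrix.unitaryGroup ν ℂ) →
        ∫ u in Ioi (0 : ℝ), NormedSpace.exp (u • (-covLapF K c m2 U₀)) = (covLapF K c m2 U₀)⁻¹) :=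
  ⟨integral_exp_neg_cxLapF_eq_inv K hc hε hwin hU hV, fun hU₀ => integral_exp_neg_covLapF_eq_inv K hc hm hU₀⟩

end Summit.QuantumFields.YangMills.BalabanUVNodes.N15KingModelRung.Covariant

end
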